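/-
Copyright (c) 2026 the pub-hodgecm-mathlib formalisation cell (harness21).  Prover seat hodgecm-mathlib-K2Liu-p05 (g2), 2026-09-04
(Track B «K2-LIT», crux hLiu418 = stmt-HodgeConjecture-24832, organ (L24-a) of socket #24i∕#30i `sig_K2LiuThetaTypeSphericalEigenvalueInert`,
LEAD F0P6-plan (g11) RULING «M-155g» (ii)).
-/
import Literature.NumberTheory.Automorphic.UnitaryGroupIsotropicRootSymplectic   -- ★ `LocalRing`, `conjLocal`, `quadraticLocalEquiv`, `reIm`, `hermForm`, `add_conjLocal`
import Literature.NumberTheory.Automorphic.LocalFieldHaarBalls                   -- ★ `LocalFieldHaar.mem_primePowBall_one_iff`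
import HarnessLib

/-!
# The dictionary `re ∕ im ↔ 𝒪_w` on `E_v = E ⊗_F F_v = Π_{w ∣ v} E_w` at a place `v ∤ 2` with `δ` a unit above `v`, and integrality of hermitian
# pairings of integral vectors

Topic: crux hLiu418 (stmt-HodgeConjecture-24832), Track B «K2-LIT», organ (L24-a) of socket #24i∕#30i (LEAD F0P6-plan (g11) RULING «M-155g» (ii)); the
plumbing between the SELF-DUAL BOX `Λ₀ = 𝒪_vᴺ × 𝒪_vᴺ ⊂ 𝕎_v = F_vᴺ × F_vᴺ` of the Schrödinger model (coordinates `reIm` of ★ `quadraticLocalEquiv`: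
`z = ι_v(re z) + ι_v(im z) δ`) and `𝒪_w`-INTEGRALITY in `E_v = Π_{w ∣ v} E_w` (the currency of the hyperspecial `U(J)(𝒪_v)` = ★ `localInt` and of integral
hyperbolic frames).  Namespace `Summit.HodgeConjecture.HodgeConjecture.Cruxes.HLiu418.K2LiuLocalRingReImDictionary`.  THEOREMS ONLY (no definition, no named
fact, no instance, no notation, no `sorry`); `--supports stmt-HodgeConjecture-24832 --as helper`; count-neutral.

THE MATHEMATICS ([CasselsFrohlichANT1967, Ch. II §10]: `L ⊗_K K_v = Π_{w ∣ v} L_w`; Ch. VII §1.1).  With `σ = c ⊗ 1` (★ `conjLocal`): `z + σ z = ι_v(2 re z)` (★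
`add_conjLocal`) and `z - σ z = ι_v(2 im z) · δ` (★ `re_conjLocal`, `im_conjLocal`, `re_add_im`); `|ι_w t|_w = |t|_v^{e(w∣v)}` (★ `valued_toPlace`); `σ` maps `𝒪_{c⁻¹w}`
onto `𝒪_w` (★ `valued_galAdicCompletionMap`).  Hence, when `2` is a `v`-unit and `δ_w` a unit at every `w ∣ v`: (§1) `z_w ∈ 𝒪_w ∀ w ⇔ re z, im z ∈ 𝒪_v`, and
`z_w ∈ 𝔭_w ∀ w ⇒ re z, im z ∈ 𝔭_v`; (§2) vector versions: `reIm x ∈ Λ₀ ⇔ x ∈ 𝒪_{E_v}ᴺ`, `x ∈ 𝔭 E_vᴺ ⇒ reIm x ∈ 𝔭ᴺ × 𝔭ᴺ`, and the hermitian pairings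
`h(y, x) = (σ y)ᵀ 𝕋_v x` of integral vectors are integral when `𝕋_v` is `v`-integral.  Consumer: ★ `Theorems/K2LiuInertWeilSphericalLineFrame.lean` ((ISO) from an
integral hyperbolic frame).

HONEST LABEL: HC_CM is proved only modulo the 7 printed citations (2 remaining named inputs: hLiu418 = stmt-HodgeConjecture-24832, h413 =
stmt-HodgeConjecture-24833) until rung 0 closes; count-neutral helper toward #24i, closes nothing.

## References
* [CasselsFrohlichANT1967] J. W. S. Cassels, A. Fröhlich (eds.), *Algebraic Number Theory* (1967), Ch. II §10, Ch. VII §1.1.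
* [MoeglinVignerasWaldspurger1987] C. Mœglin, M.-F. Vignéras, J.-L. Waldspurger, LNM 1291 (1987), Chap. 5 I.1 (self-dual lattices, unramified data).
-/

set_option autoImplicit false
set_option linter.dupNamespace false

noncomputable section

open NumberField IsDedekindDomain
open scoped Matrix NNReal
open Literature.RepresentationTheory.HeisenbergGroup
open Literature.NumberTheory.Automorphic
open Literature.NumberTheory.Automorphic.UnitaryGroup
open Literature.NumberTheory.GelbartRogawski1991.UnitaryDualPair.LocalSplitting
open Literature.NumberTheory.GaloisRepresentations.IsNonarchimedeanLocalField

namespace Summit.HodgeConjecture.HodgeConjecture.Cruxes.HLiu418.K2LiuLocalRingReImDictionary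

/-! ## §1 Scalars: `re ∕ im ↔ 𝒪_w` at a place `v ∤ 2` with `δ` a unit above `v` -/

section Dictionary

variable {F : Type} [Field F] [NumberField F] (E : Type) [Field E] [NumberField E] [Algebra F E]
  [Algebra.IsQuadraticExtension F E] (c : E ≃ₐ[F] E) {δ : E} (hcδ : c δ = -δ) (hδ : δ ≠ 0) {d : F}
  (hd : δ * δ = algebraMap F E d) (v : HeightOneSpectrum (𝓞 F))

omit [NumberField F] [Algebra.IsQuadraticExtension F E] in
/-- `e(w ∣ v) ≠ 0`. [cite: CasselsFrohlichANT1967, Ch. II §10] -/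
theorem ramificationIdx'_ne_zero_placesOver (w : PlacesOver E v) : v.asIdeal.ramificationIdx' w.1.asIdeal ≠ 0 := by
  haveI := PlacesOver.liesOver (E := E) w
  exact Ideal.IsDedekindDomain.ramificationIdx'_ne_zero_of_liesOver w.1.asIdeal v.ne_bot

omit [Algebra.IsQuadraticExtension F E] in
/-- `σ = c ⊗ 1` preserves integrality at every `w ∣ v` (`σ 𝒪_{c⁻¹w} = 𝒪_w`, ★ `valued_galAdicCompletionMap`). [cite: CasselsFrohlichANT1967, Ch. VII §1.1] -/
theorem conjLocal_apply_mem_integers {z : LocalRing E v} (hz : ∀ w : PlacesOver E v, z w ∈ w.1.adicCompletionIntegers E)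
    (w : PlacesOver E v) : conjLocal E c v z w ∈ w.1.adicCompletionIntegers E := by
  have h := hz ⟨c⁻¹ • w.1, under_inv_smul_eq c w⟩
  rw [conjLocal_apply]
  exact (galAdicCompletionMap_mem_adicCompletionIntegers_iff E c (smul_inv_smul c w.1) _).2 h

omit [Algebra.IsQuadraticExtension F E] in
/-- `σ = c ⊗ 1` preserves strict smallness at every `w ∣ v`. [cite: CasselsFrohlichANT1967, Ch. VII §1.1] -/
theorem valued_conjLocal_apply_lt_one {z : LocalRing E v} (hz : ∀ w : PlacesOver E v, Valued.v (z w) < 1) (w : PlacesOver E v) :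
    Valued.v (conjLocal E c v z w) < 1 := by
  have h := hz ⟨c⁻¹ • w.1, under_inv_smul_eq c w⟩
  rw [conjLocal_apply, valued_galAdicCompletionMap]
  exact h

include hd in
/-- `z + σ z = ι_v(2 re z)` read at `w`: `|(z + σ z)_w| = |2 re z|_v ^ e(w ∣ v)`. [cite: CasselsFrohlichANT1967, Ch. II §10] -/
theorem valued_add_conjLocal_apply (z : LocalRing E v) (w : PlacesOver E v) :
    Valued.v ((z + conjLocal E c v z) w) =
      Valued.v (2 * QuadraticCoordinates.re (quadraticLocalEquiv E v c hcδ hδ).toLinearEquiv.toAddEquiv z) ^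
        v.asIdeal.ramificationIdx' w.1.asIdeal := by
  rw [add_conjLocal E c hcδ hδ hd v z, toLocalRing_apply, valued_toPlace]

include hd in
/-- `z - σ z = ι_v(2 im z) · δ` read at `w`: `|(z - σ z)_w| = |2 im z|_v ^ e(w ∣ v) · |δ_w|`. [cite: CasselsFrohlichANT1967, Ch. II §10] -/
theorem valued_sub_conjLocal_apply (z : LocalRing E v) (w : PlacesOver E v) :
    Valued.v ((z - conjLocal E c v z) w) =
      Valued.v (2 * QuadraticCoordinates.im (quadraticLocalEquiv E v c hcδ hδ).toLinearEquiv.toAddEquiv z) ^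
          v.asIdeal.ramificationIdx' w.1.asIdeal * Valued.v (algebraMap E (LocalRing E v) δ w) := by
  have hq := isQuadraticCoordinates_local E v c hcδ hδ hd
  have hsub : z - conjLocal E c v z =
      toLocalRing E v (2 * QuadraticCoordinates.im (quadraticLocalEquiv E v c hcδ hδ).toLinearEquiv.toAddEquiv z) *
        algebraMap E (LocalRing E v) δ := by
    have h1 := hq.re_add_im z
    have h2 := hq.re_add_im (conjLocal E c v z)
    rw [re_conjLocal E c hcδ hδ hd v, im_conjLocal E c hcδ hδ hd v, map_neg] at h2
    calc z - conjLocal E c v z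
        = (toLocalRing E v (QuadraticCoordinates.re (quadraticLocalEquiv E v c hcδ hδ).toLinearEquiv.toAddEquiv z) +
            toLocalRing E v (QuadraticCoordinates.im (quadraticLocalEquiv E v c hcδ hδ).toLinearEquiv.toAddEquiv z) *
              algebraMap E (LocalRing E v) δ) -
          (toLocalRing E v (QuadraticCoordinates.re (quadraticLocalEquiv E v c hcδ hδ).toLinearEquiv.toAddEquiv z) +
            -toLocalRing E v (QuadraticCoordinates.im (quadraticLocalEquiv E v c hcδ hδ).toLinearEquiv.toAddEquiv z) *
              algebraMap E (LocalRing E v) δ) := by rw [h1, h2]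
      _ = _ := by rw [map_mul, map_ofNat]; ring
  rw [hsub, Pi.mul_apply, map_mul, toLocalRing_apply, valued_toPlace]

include hd in
/-- **the dictionary, `≤ 1`**: at a place where `2` is a `v`-unit and `δ` a unit above `v`, an element of `E_v` integral at EVERY `w ∣ v` has `re z, im z ∈ 𝒪_v`.
[cite: CasselsFrohlichANT1967, Ch. II §10] -/
theorem re_im_mem_integers_of_forall_mem (h2 : Valued.v (2 : v.adicCompletion F) = 1)
    (hδu : ∀ w : PlacesOver E v, Valued.v (algebraMap E (LocalRing E v) δ w) = 1)
    {z : LocalRing E v} (hz : ∀ w : PlacesOver E v, z w ∈ w.1.adicCompletionIntegers E) :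
    QuadraticCoordinates.re (quadraticLocalEquiv E v c hcδ hδ).toLinearEquiv.toAddEquiv z ∈ v.adicCompletionIntegers F ∧
      QuadraticCoordinates.im (quadraticLocalEquiv E v c hcδ hδ).toLinearEquiv.toAddEquiv z ∈ v.adicCompletionIntegers F := by
  obtain ⟨w⟩ := PlacesOver.nonempty E v
  have he := ramificationIdx'_ne_zero_placesOver E v w
  have hσ := conjLocal_apply_mem_integers E c v hz w
  rw [HeightOneSpectrum.mem_adicCompletionIntegers] at hσ
  have hzw := hz w
  rw [HeightOneSpectrum.mem_adicCompletionIntegers] at hzw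
  constructor
  · have hs : Valued.v ((z + conjLocal E c v z) w) ≤ 1 := by
      rw [Pi.add_apply]
      exact (Valuation.map_add _ _ _).trans (max_le hzw hσ)
    rw [valued_add_conjLocal_apply E c hcδ hδ hd v z w, pow_le_one_iff he, map_mul, h2, one_mul] at hs
    exact (HeightOneSpectrum.mem_adicCompletionIntegers _ _ _).2 hs
  · have hs : Valued.v ((z - conjLocal E c v z) w) ≤ 1 := by
      rw [Pi.sub_apply]
      exact (Valuation.map_sub _ _ _).trans (max_le hzw hσ)
    rw [valued_sub_conjLocal_apply E c hcδ hδ hd v z w, hδu w, mul_one, pow_le_one_iff he, map_mul, h2, one_mul] at hs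
    exact (HeightOneSpectrum.mem_adicCompletionIntegers _ _ _).2 hs

include hd in
/-- **the dictionary, `< 1`**: under the same hypotheses, an element of `E_v` lying in `𝔭_w` at EVERY `w ∣ v` has `re z, im z ∈ 𝔭_v`.
[cite: CasselsFrohlichANT1967, Ch. II §10] -/
theorem re_im_mem_primePowBall_one_of_forall_lt (h2 : Valued.v (2 : v.adicCompletion F) = 1)
    (hδu : ∀ w : PlacesOver E v, Valued.v (algebraMap E (LocalRing E v) δ w) = 1)
    {z : LocalRing E v} (hz : ∀ w : PlacesOver E v, Valued.v (z w) < 1) :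
    QuadraticCoordinates.re (quadraticLocalEquiv E v c hcδ hδ).toLinearEquiv.toAddEquiv z ∈ primePowBall (v.adicCompletion F) 1 ∧
      QuadraticCoordinates.im (quadraticLocalEquiv E v c hcδ hδ).toLinearEquiv.toAddEquiv z ∈ primePowBall (v.adicCompletion F) 1 := by
  obtain ⟨w⟩ := PlacesOver.nonempty E v
  have he := ramificationIdx'_ne_zero_placesOver E v w
  have hσ := valued_conjLocal_apply_lt_one E c v hz w
  have hzw := hz w
  have key : ∀ t : v.adicCompletion F, Valued.v t < 1 → t ∈ primePowBall (v.adicCompletion F) 1 := fun t ht => by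
    refine LocalFieldHaar.mem_primePowBall_one_iff.2 (normAbs_lt_one_iff.1 ?_)
    have h1 : ¬ normAbs (v.adicCompletion F) 1 ≤ normAbs (v.adicCompletion F) t := by
      rw [normAbs_le_normAbs_iff_valued, map_one, not_le]
      exact ht
    rw [map_one, not_le] at h1
    exact h1
  constructor
  · have hs : Valued.v ((z + conjLocal E c v z) w) < 1 := by
      rw [Pi.add_apply]
      exact (Valuation.map_add _ _ _).trans_lt (max_lt hzw hσ)
    rw [valued_add_conjLocal_apply E c hcδ hδ hd v z w, pow_lt_one_iff he, map_mul, h2, one_mul] at hs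
    exact key _ hs
  · have hs : Valued.v ((z - conjLocal E c v z) w) < 1 := by
      rw [Pi.sub_apply]
      exact (Valuation.map_sub _ _ _).trans_lt (max_lt hzw hσ)
    rw [valued_sub_conjLocal_apply E c hcδ hδ hd v z w, hδu w, mul_one, pow_lt_one_iff he, map_mul, h2, one_mul] at hs
    exact key _ hs

include hd in
/-- **the dictionary, converse**: `re z, im z ∈ 𝒪_v` and `δ` integral above `v` give `z` integral at every `w ∣ v` (`z = ι_v(re z) + ι_v(im z) δ`).
[cite: CasselsFrohlichANT1967, Ch. II §10] -/
theorem forall_mem_integers_of_re_im_mem (hδu : ∀ w : PlacesOver E v, Valued.v (algebraMap E (LocalRing E v) δ w) = 1)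
    {z : LocalRing E v}
    (hre : QuadraticCoordinates.re (quadraticLocalEquiv E v c hcδ hδ).toLinearEquiv.toAddEquiv z ∈ v.adicCompletionIntegers F)
    (him : QuadraticCoordinates.im (quadraticLocalEquiv E v c hcδ hδ).toLinearEquiv.toAddEquiv z ∈ v.adicCompletionIntegers F)
    (w : PlacesOver E v) : z w ∈ w.1.adicCompletionIntegers E := by
  have hq := isQuadraticCoordinates_local E v c hcδ hδ hd
  rw [← hq.re_add_im z, Pi.add_apply, Pi.mul_apply, toLocalRing_apply, toLocalRing_apply]
  refine add_mem (toPlace_mem_adicCompletionIntegers v w hre) (mul_mem (toPlace_mem_adicCompletionIntegers v w him) ?_)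
  rw [HeightOneSpectrum.mem_adicCompletionIntegers]
  exact (hδu w).le

end Dictionary

/-! ## §2 Vectors: the self-dual box `Λ₀ = reIm(𝒪_{E_v}ᴺ)`, the small box, and integral pairings -/

section Vectors

variable {F : Type} [Field F] [NumberField F] (E : Type) [Field E] [NumberField E] [Algebra F E]
  [Algebra.IsQuadraticExtension F E] (c : E ≃ₐ[F] E) (N : ℕ) {δ : E} (hcδ : c δ = -δ) (hδ : δ ≠ 0) {d : F}
  (hd : δ * δ = algebraMap F E d) (T : Matrix (Fin N) (Fin N) F)
  {J : Matrix (Fin N) (Fin N) E} (hJ : J = T.map (algebraMap F E))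
  (v : HeightOneSpectrum (𝓞 F))

include hd in
/-- **`Λ₀ = reIm(𝒪_{E_v}ᴺ)`**: a box vector is the `reIm` of a vector integral at every `w ∣ v` (dictionary §5). [cite: CasselsFrohlichANT1967, Ch. II §10] -/
theorem forall_mem_integers_of_reIm_mem_box
    (hδu : ∀ w : PlacesOver E v, Valued.v (algebraMap E (LocalRing E v) δ w) = 1) (x : Fin N → LocalRing E v)
    (hx : QuadraticCoordinates.reIm (quadraticLocalEquiv E v c hcδ hδ).toLinearEquiv.toAddEquiv (Fin N) x ∈
      piPrimePowBall (v.adicCompletion F) (Fin N) 0 ×ˢ piPrimePowBall (v.adicCompletion F) (Fin N) 0)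
    (j : Fin N) (w : PlacesOver E v) : x j w ∈ w.1.adicCompletionIntegers E := by
  refine forall_mem_integers_of_re_im_mem E c hcδ hδ hd v hδu ?_ ?_ w
  · rw [← mem_primePowBall_zero_iff, ← QuadraticCoordinates.reIm_apply_fst]
    exact (mem_piPrimePowBall_iff).1 hx.1 j
  · rw [← mem_primePowBall_zero_iff, ← QuadraticCoordinates.reIm_apply_snd]
    exact (mem_piPrimePowBall_iff).1 hx.2 j

include hd in
/-- conversely, the `reIm` of an integral vector lies in the box `Λ₀`. [cite: CasselsFrohlichANT1967, Ch. II §10] -/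
theorem reIm_mem_box_of_forall_mem_integers (h2 : Valued.v (2 : v.adicCompletion F) = 1)
    (hδu : ∀ w : PlacesOver E v, Valued.v (algebraMap E (LocalRing E v) δ w) = 1) (x : Fin N → LocalRing E v)
    (hx : ∀ (j : Fin N) (w : PlacesOver E v), x j w ∈ w.1.adicCompletionIntegers E) :
    QuadraticCoordinates.reIm (quadraticLocalEquiv E v c hcδ hδ).toLinearEquiv.toAddEquiv (Fin N) x ∈
      piPrimePowBall (v.adicCompletion F) (Fin N) 0 ×ˢ piPrimePowBall (v.adicCompletion F) (Fin N) 0 := by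
  refine ⟨(mem_piPrimePowBall_iff).2 fun j => ?_, (mem_piPrimePowBall_iff).2 fun j => ?_⟩
  · rw [QuadraticCoordinates.reIm_apply_fst, mem_primePowBall_zero_iff]
    exact (re_im_mem_integers_of_forall_mem E c hcδ hδ hd v h2 hδu (hx j)).1
  · rw [QuadraticCoordinates.reIm_apply_snd, mem_primePowBall_zero_iff]
    exact (re_im_mem_integers_of_forall_mem E c hcδ hδ hd v h2 hδu (hx j)).2

include hd in
/-- the `reIm` of a vector in `𝔭_w E_vᴺ` (every coordinate of valuation `< 1` at every `w`) lies in the small box `𝔭_vᴺ × 𝔭_vᴺ`.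
[cite: CasselsFrohlichANT1967, Ch. II §10] -/
theorem reIm_mem_smallBox_of_forall_lt (h2 : Valued.v (2 : v.adicCompletion F) = 1)
    (hδu : ∀ w : PlacesOver E v, Valued.v (algebraMap E (LocalRing E v) δ w) = 1) (x : Fin N → LocalRing E v)
    (hx : ∀ (j : Fin N) (w : PlacesOver E v), Valued.v (x j w) < 1) :
    QuadraticCoordinates.reIm (quadraticLocalEquiv E v c hcδ hδ).toLinearEquiv.toAddEquiv (Fin N) x ∈
      piPrimePowBall (v.adicCompletion F) (Fin N) 1 ×ˢ piPrimePowBall (v.adicCompletion F) (Fin N) 1 := by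
  refine ⟨(mem_piPrimePowBall_iff).2 fun j => ?_, (mem_piPrimePowBall_iff).2 fun j => ?_⟩
  · rw [QuadraticCoordinates.reIm_apply_fst]
    exact (re_im_mem_primePowBall_one_of_forall_lt E c hcδ hδ hd v h2 hδu (hx j)).1
  · rw [QuadraticCoordinates.reIm_apply_snd]
    exact (re_im_mem_primePowBall_one_of_forall_lt E c hcδ hδ hd v h2 hδu (hx j)).2

include hJ in
omit [Algebra.IsQuadraticExtension F E] in
/-- **pairings of integral vectors are integral** when `𝕋_v` is `v`-integral: `h(y, x)_w ∈ 𝒪_w`. [cite: MoeglinVignerasWaldspurger1987, Chap. 5 I.1] -/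
theorem hermForm_apply_mem_integers (hTi : ∀ i j, localGram F N T v i j ∈ primePowBall (v.adicCompletion F) 0)
    {y x : Fin N → LocalRing E v} (hy : ∀ (j : Fin N) (w : PlacesOver E v), y j w ∈ w.1.adicCompletionIntegers E)
    (hx : ∀ (j : Fin N) (w : PlacesOver E v), x j w ∈ w.1.adicCompletionIntegers E) (w : PlacesOver E v) :
    hermForm (conjLocal E c v) ((adelicForm E N J).map (adeleToLocal E v)) y x w ∈ w.1.adicCompletionIntegers E := by
  rw [localForm_eq_map E N v T hJ, hermForm, dotProduct, Finset.sum_apply]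
  refine sum_mem fun i _ => ?_
  rw [Pi.mul_apply, Function.comp_apply, Matrix.mulVec, dotProduct, Finset.sum_apply]
  refine mul_mem (conjLocal_apply_mem_integers E c v (hy i) w) (sum_mem fun j _ => ?_)
  rw [Pi.mul_apply, Matrix.map_apply, Matrix.map_apply, toLocalRing_apply]
  exact mul_mem (toPlace_mem_adicCompletionIntegers v w ((mem_primePowBall_zero_iff _).1 (hTi i j))) (hx j w)

end Vectors

end Summit.HodgeConjecture.HodgeConjecture.Cruxes.HLiu418.K2LiuLocalRingReImDictionary

end
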